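import Summits.QuantumFields.GaugeBoot.BaryonThetaObservable
import HarnessLib

/-!
# Layer networks: observables read on finitely many links with an entry expansion, and their slab transfer (gauge-boot, L3 negative supplement; SU(N odd) link reflection at `β < 0`, part 2)

HONEST FRAMING (cell `pub-gaugeboot`, page 1 of every file): the venture produces certified bounds
on lattice expectations at stated coupling, gauge group, dimension and torus size; NOT a mass gap,
NOT a continuum limit, NOT a string tension; NOT Yang–Mills-summit-bearing (barriers
`FixedCouplingUltralocality`, `PerturbativeInvisibility`). Bookkeeping for a NEGATIVE structural
result (`FrameLinkRPLayerNet.lean`): link reflection positivity fails at every `β < 0` for every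
layer network with an ODD number of links (e.g. the `N`-leg baryon star of `SU(N)`, `N` odd).

`BaryonThetaObservable.lean` treats ONE test function (the seven-link theta graph of a
three-dimensional representation). This file abstracts exactly what its slab computation used.
A **layer network** on a periodic lattice `(A, e)` with gauge group `G` and representation
`ρ : G → M_N(ℂ)` consists of an injective family of links `t : J → Link A d` (`J` finite), orientation
flags `o : J → Bool`, and a value function `Ω : (J → G) → ℂ`; its observable is
`netObs t Ω U = Ω (j ↦ U (t j))`. Two structural hypotheses:

* `IsEntryExpansion ρ o Ω κ γ δ` — `Ω(v) = ∑_ι κ_ι ∏_j (ρ(v_j^{±1}))_{γ_j(ι) δ_j(ι)}` (`repOr`): `Ω` is a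
  finite sum of products of ONE entry of each oriented link matrix (multi-affine); e.g. traces of
  words using each letter once, or `ε`-contractions of transporters (`Baryon.baryonForm_legMat_eq_sum`);
* `IsGaugeInvariant ρ e t Ω` — invariance under `v_j ↦ g_{x_j} v_j g_{x_j + e_{n_j}}⁻¹` for gauge
  functions `g` with `det ρ(g_z) = 1` (`t j = (x_j, n_j)`).

Results ([folklore] bookkeeping; Fubini and invariance of Haar measure, no character expansion):

* `IsEntryExpansion.continuous`, `continuous_netObs`, `netObs_congr`, `netObs_gaugeAct`;
* `integral_normSq_netObs_pos` — `Ω(1) ≠ 0 ⇒ 0 < ∫ |netObs|² dμ₀`;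
* `integral_prod_weight_mul_sum_prod_entry_fintype` — `MultilinkSlabIntegral` for any finite index type;
* **`net_slab_integral`** / **`net_slab_integral_frozen`** — against one-link class weights
  `w(a_s Y_s⁻¹ b_s)` on a block `S ⊇ t(J)`,
  `∫ netObs(Y) ∏_{s∈S} w(a_s Y_s⁻¹ b_s) dμ(Y) = z^{|S|-|J|} c^{|J|} netObs(s ↦ b_s a_s)` (`z = ∫ w`,
  `wAvg ρ w = c • 1`): a slab transfers the network one layer down with the factor `c^{|J|}` — whose
  sign at `β < 0` is `(-1)^{|J|}` for `SU(N)`, `N` odd (`WilsonWeightNegativeBeta.lean`).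

References: K. Osterwalder, E. Seiler, Ann. Phys. 110 (1978) 440, §2; M. Creutz, Quarks, Gluons and
Lattices (1983) Ch. 8; I. Montvay, G. Münster, Quantum Fields on a Lattice (1994) §3.2.
-/

noncomputable section

open MeasureTheory Complex
open scoped Matrix ComplexConjugate
open Literature.MathematicalPhysics.QuantumFieldTheory (haarProbability)
open Literature.MathematicalPhysics.QuantumFieldTheory.LatticeRP (integral_mul_eq_of_dependsOn
  integral_comp_eq_of_measurePreserving)
open Literature.RepresentationTheory.CompactGroups

namespace Summit.QuantumFields.GaugeBoot

namespace LayerNet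

open TiltedRP TwistedSlab Baryon

variable {A : Type*} {d N : ℕ}
variable {G : Type*} [Group G] (ρ : G →* Matrix (Fin N) (Fin N) ℂ)
variable {J : Type*} [Fintype J]

/-! ## Layer networks -/

/-- **The observable of a network**: the value function `Ω` read on the link variables `U (t j)`.
[folklore] -/
def netObs (t : J → Link A d) (Ω : (J → G) → ℂ) (U : Config A d G) : ℂ :=
  Ω fun j => U (t j)

/-- **Entry expansion** of a value function: `Ω(v) = ∑_ι κ_ι ∏_j (repOr ρ (o j) (v j))_{γ_j(ι) δ_j(ι)}`
— a finite sum of products of one entry of each oriented link matrix. [folklore] -/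
def IsEntryExpansion (o : J → Bool) (Ω : (J → G) → ℂ) {I : Type*} [Fintype I] (κ : I → ℂ)
    (γ δ : J → I → Fin N) : Prop :=
  ∀ v, Ω v = ∑ ι, κ ι * ∏ j, repOr ρ (o j) (v j) (γ j ι) (δ j ι)

/-- **Gauge invariance** of a value function on the links `t j = (x_j, n_j)`: for every gauge
function `g : A → G` with `det ρ(g_z) = 1`, `Ω(j ↦ g_{x_j} v_j g_{x_j + e_{n_j}}⁻¹) = Ω(v)`. [folklore] -/
def IsGaugeInvariant [AddCommGroup A] (e : Fin d → A) (t : J → Link A d) (Ω : (J → G) → ℂ) : Prop :=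
  ∀ (g : A → G) (v : J → G), (∀ z, (ρ (g z)).det = 1) →
    Ω (fun j => g (t j).1 * v j * (g ((t j).1 + e (t j).2))⁻¹) = Ω v

omit [Fintype J] [Group G] in
/-- The network observable depends only on the link variables it reads (and on `t` only through
them). [folklore] -/
theorem netObs_congr {t t' : J → Link A d} {Ω : (J → G) → ℂ} {U U' : Config A d G}
    (h : ∀ j, U (t j) = U' (t' j)) : netObs t Ω U = netObs t' Ω U' :=
  congrArg Ω (funext h)

omit [Fintype J] in
/-- **Gauge invariance of the network observable** under `Baryon.gaugeAct`. [folklore] -/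
theorem netObs_gaugeAct [AddCommGroup A] {e : Fin d → A} {t : J → Link A d} {Ω : (J → G) → ℂ}
    (hG : IsGaugeInvariant ρ e t Ω) (g : A → G) (hdet : ∀ z, (ρ (g z)).det = 1) (U : Config A d G) :
    netObs t Ω (gaugeAct e g U) = netObs t Ω U :=
  hG g _ hdet

/-! ## Continuity and non-vanishing -/

section Analysis

variable [TopologicalSpace G] [IsTopologicalGroup G]
variable {o : J → Bool} {Ω : (J → G) → ℂ} {I : Type*} [Fintype I] {κ : I → ℂ} {γ δ : J → I → Fin N}

/-- A value function with an entry expansion is continuous. [folklore] -/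
theorem IsEntryExpansion.continuous (hΩ : IsEntryExpansion ρ o Ω κ γ δ) (hρ : Continuous ρ) :
    Continuous Ω := by
  rw [show Ω = fun v => ∑ ι, κ ι * ∏ j, repOr ρ (o j) (v j) (γ j ι) (δ j ι) from funext hΩ]
  refine continuous_finsetSum _ fun ι _ => continuous_const.mul (continuous_finsetProd _ fun j _ => ?_)
  exact ((continuous_repOr ρ hρ (o j)).comp (continuous_apply j)).matrix_elem _ _

omit [Fintype J] [Group G] [IsTopologicalGroup G] in
/-- The network observable of a continuous value function is continuous. [folklore] -/
theorem continuous_netObs (t : J → Link A d) (hΩc : Continuous Ω) :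
    Continuous (netObs (A := A) (d := d) t Ω) :=
  hΩc.comp (continuous_pi fun j => continuous_apply (t j))

omit [Fintype J] [Group G] [IsTopologicalGroup G] in
/-- A uniform bound on the network observable (compact configuration space). [folklore] -/
theorem exists_norm_netObs_le [Fintype A] [CompactSpace G] (t : J → Link A d) (hΩc : Continuous Ω) :
    ∃ C : ℝ, ∀ U : Config A d G, ‖netObs t Ω U‖ ≤ C := by
  obtain ⟨C, hC⟩ := (isCompact_univ.image (continuous_netObs t hΩc)).isBounded.exists_norm_le
  exact ⟨C, fun U => hC _ ⟨U, Set.mem_univ _, rfl⟩⟩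

variable [Fintype A] [CompactSpace G] [MeasurableSpace G] [BorelSpace G] [SecondCountableTopology G]

omit [Fintype J] in
/-- **`0 < ∫ |netObs|² dμ₀`** when `Ω(1) ≠ 0`: the observable is continuous, non-zero at `U ≡ 1`, and
the product Haar measure charges non-empty open sets. [folklore] -/
theorem integral_normSq_netObs_pos (t : J → Link A d) (hΩc : Continuous Ω)
    (h1 : Ω (fun _ => 1) ≠ 0) :
    0 < ∫ V, ‖netObs t Ω V‖ ^ 2 ∂(productHaar A d G) := by
  haveI := isProbabilityMeasure_productHaar (A := A) (d := d) (G := G)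
  haveI : IsProbabilityMeasure (haarProbability G) :=
    CompactGroup.isProbabilityMeasure_haarMeasure_top
  haveI : (haarProbability G).IsOpenPosMeasure := by
    unfold haarProbability; infer_instance
  haveI : (productHaar A d G).IsOpenPosMeasure := by
    unfold productHaar; infer_instance
  have hc : Continuous fun V : Config A d G => ‖netObs t Ω V‖ ^ 2 :=
    (continuous_netObs t hΩc).norm.pow 2
  have hint : Integrable (fun V : Config A d G => ‖netObs t Ω V‖ ^ 2) (productHaar A d G) :=
    hc.integrable_of_hasCompactSupport (HasCompactSupport.of_compactSpace _)
  rw [integral_pos_iff_support_of_nonneg (fun V => sq_nonneg _) hint]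
  have hopen : IsOpen {V : Config A d G | 0 < ‖netObs t Ω V‖ ^ 2} := isOpen_lt continuous_const hc
  have hone : (fun _ => (1 : G)) ∈ {V : Config A d G | 0 < ‖netObs t Ω V‖ ^ 2} := by
    show 0 < ‖netObs t Ω fun _ => (1 : G)‖ ^ 2
    exact pow_pos (norm_pos_iff.2 h1) 2
  refine lt_of_lt_of_le (hopen.measure_pos _ ⟨_, hone⟩) (measure_mono fun V hV => ?_)
  rw [Function.mem_support]
  exact ne_of_gt hV

omit [SecondCountableTopology G] [Fintype J] in
/-- **`∫ conj netObs · netObs dμ₀` is the real number `∫ |netObs|² dμ₀`.** [folklore] -/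
theorem integral_conj_netObs_mul_self (t : J → Link A d) (Ω : (J → G) → ℂ) :
    ∫ V, conj (netObs t Ω V) * netObs t Ω V ∂(productHaar A d G) =
      ((∫ V, ‖netObs t Ω V‖ ^ 2 ∂(productHaar A d G) : ℝ) : ℂ) := by
  rw [← integral_complex_ofReal]
  refine integral_congr_ae (ae_of_all _ fun V => ?_)
  dsimp only
  rw [Complex.conj_mul', Complex.ofReal_pow]

end Analysis

/-! ## The slab transfer of a layer network -/

section Slab

variable [Fintype A] [DecidableEq A] [TopologicalSpace G] [IsTopologicalGroup G] [CompactSpace G]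
  [MeasurableSpace G] [BorelSpace G] [SecondCountableTopology G]

variable {w : G → ℝ} (hw : Continuous w) (hinv : ∀ k, w k⁻¹ = w k) {c : ℂ}
  (hc : wAvg ρ w = c • (1 : Matrix (Fin N) (Fin N) ℂ)) (hρ : Continuous ρ)
include hw hinv hc hρ

/-- `MultilinkSlabIntegral.integral_prod_weight_mul_sum_prod_entry` for links indexed by any finite
type `J` (reindexing along `Fintype.equivFin`). [folklore] -/
theorem integral_prod_weight_mul_sum_prod_entry_fintype (S : Finset (Link A d)) (t : J → Link A d)
    (ht : Function.Injective t) (htS : ∀ j, t j ∈ S) (o : J → Bool) (L R : J → G)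
    {I : Type*} [Fintype I] (κ : I → ℂ) (γ δ : J → I → Fin N) :
    ∫ Y, (∏ s ∈ S, (w (Y s) : ℂ)) *
        ∑ ι, κ ι * ∏ j, (ρ (L j) * repOr ρ (o j) (Y (t j)) * ρ (R j)) (γ j ι) (δ j ι)
          ∂(productHaar A d G) =
      (∫ k, (w k : ℂ) ∂(haarProbability G)) ^ (S.card - Fintype.card J) * c ^ (Fintype.card J) *
        ∑ ι, κ ι * ∏ j, ρ (L j * R j) (γ j ι) (δ j ι) := by
  set ε : Fin (Fintype.card J) ≃ J := (Fintype.equivFin J).symm with hε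
  have h1 : ∀ f : J → ℂ, ∏ j, f j = ∏ r : Fin (Fintype.card J), f (ε r) := fun f =>
    (Fintype.prod_equiv ε (fun r => f (ε r)) f fun r => rfl).symm
  simp only [h1]
  exact integral_prod_weight_mul_sum_prod_entry ρ hw hinv hc hρ S (fun r => t (ε r))
    (ht.comp ε.injective) (fun r => htS _) (fun r => o (ε r)) (fun r => L (ε r)) (fun r => R (ε r))
    κ (fun r ι => γ (ε r) ι) (fun r ι => δ (ε r) ι)

variable {o : J → Bool} {Ω : (J → G) → ℂ} {I : Type*} [Fintype I] {κ : I → ℂ} {γ δ : J → I → Fin N}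
  (hΩ : IsEntryExpansion ρ o Ω κ γ δ) (t : J → Link A d)
include hΩ

/-- **The slab integral of a layer network.** For a block `S` containing the (distinct) links `t j`
and constants `a, b : Link → G`:
`∫ netObs(Y) ∏_{s ∈ S} w(a_s Y_s⁻¹ b_s) dμ(Y) = z^{|S|-|J|} c^{|J|} netObs(s ↦ b_s a_s)` (`z = ∫ w dk`).
[folklore] -/
theorem net_slab_integral (S : Finset (Link A d)) (a b : Link A d → G)
    (hinj : Function.Injective t) (hS : ∀ j, t j ∈ S) :
    ∫ Y, netObs t Ω Y * ∏ s ∈ S, (w (a s * (Y s)⁻¹ * b s) : ℂ) ∂(productHaar A d G) =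
      (∫ k, (w k : ℂ) ∂(haarProbability G)) ^ (S.card - Fintype.card J) * c ^ (Fintype.card J) *
        netObs t Ω (fun s => b s * a s) := by
  have hΩc := hΩ.continuous ρ hρ
  -- substitute `Y_s ↦ b_s Y_s⁻¹ a_s` on `S`
  have hsub := measurePreserving_slabSubst S a b
  have hcont : Continuous fun Y : Config A d G =>
      netObs t Ω Y * ∏ s ∈ S, (w (a s * (Y s)⁻¹ * b s) : ℂ) :=
    (continuous_netObs t hΩc).mul (continuous_finsetProd _ fun s _ =>
      continuous_ofReal.comp (hw.comp ((continuous_const.mul (continuous_apply s).inv).mul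
        continuous_const)))
  rw [← integral_comp_eq_of_measurePreserving hsub hcont.measurable]
  -- one-link algebra (`Baryon.repOr_conj_inv` / `rho_transfer_eq_repOr`, any `N`)
  have hconj : ∀ (o' : Bool) (a' b' y : G), repOr ρ o' (b' * y⁻¹ * a') =
      ρ (if o' then a'⁻¹ else b') * repOr ρ (!o') y * ρ (if o' then b'⁻¹ else a') := by
    intro o' a' b' y
    cases o'
    · simp [repOr, map_mul]
    · simp [repOr, map_mul, mul_inv_rev, mul_assoc]
  have htrans : ∀ (o' : Bool) (a' b' : G),
      ρ ((if o' then a'⁻¹ else b') * (if o' then b'⁻¹ else a')) = repOr ρ o' (b' * a') := by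
    intro o' a' b'
    cases o'
    · simp [repOr]
    · simp [repOr, mul_inv_rev]
  -- the integrand after substitution, in entry-expanded form
  set L : J → G := fun j => if o j then (a (t j))⁻¹ else b (t j) with hL
  set R : J → G := fun j => if o j then (b (t j))⁻¹ else a (t j) with hR
  have hobs : ∀ Y : Config A d G, netObs t Ω (slabSubst S a b Y) =
      ∑ ι, κ ι * ∏ j, (ρ (L j) * repOr ρ (!o j) (Y (t j)) * ρ (R j)) (γ j ι) (δ j ι) := by
    intro Y
    have hM : ∀ j, repOr ρ (o j) (slabSubst S a b Y (t j)) =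
        ρ (L j) * repOr ρ (!o j) (Y (t j)) * ρ (R j) := fun j => by
      rw [slabSubst_apply_of_mem S a b Y (hS j), hconj]
    rw [netObs, hΩ]
    simp only [hM]
  have hW : ∀ Y : Config A d G, ∏ s ∈ S, (w (a s * (slabSubst S a b Y s)⁻¹ * b s) : ℂ) =
      ∏ s ∈ S, (w (Y s) : ℂ) := fun Y =>
    Finset.prod_congr rfl fun s hs => by rw [weightArg_slabSubst S a b Y hs]
  have hA : ∀ Y : Config A d G,
      netObs t Ω (slabSubst S a b Y) * ∏ s ∈ S, (w (a s * (slabSubst S a b Y s)⁻¹ * b s) : ℂ) =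
      (∏ s ∈ S, (w (Y s) : ℂ)) *
        ∑ ι, κ ι * ∏ j, (ρ (L j) * repOr ρ (!o j) (Y (t j)) * ρ (R j)) (γ j ι) (δ j ι) := fun Y => by
    rw [hobs, hW, mul_comm]
  simp_rw [hA]
  rw [integral_prod_weight_mul_sum_prod_entry_fintype ρ hw hinv hc hρ S t hinj hS (fun j => !o j) L R
    κ γ δ]
  congr 1
  -- refold the transferred observable
  have hT : ∀ j, ρ (L j * R j) = repOr ρ (o j) (b (t j) * a (t j)) :=
    fun j => htrans (o j) _ _
  rw [netObs, hΩ]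
  simp only [hT]

/-- **The slab integral of a layer network with frozen neighbours.** Weights on the block `C` of
the form `w(a_s(U) U_s⁻¹ b_s(U))` with `a_s, b_s` continuous functions of the configuration OFF the
block, `g` continuous depending only on the configuration off the block, the links `t j` in `C`:
`∫ g(U) netObs(U) ∏_{s∈C} w(a_s(U) U_s⁻¹ b_s(U)) dμ(U) = z^{|C|-|J|} c^{|J|} ∫ g(U) netObs(s ↦ b_s(U) a_s(U)) dμ(U)`.
[folklore] -/
theorem net_slab_integral_frozen (C : Finset (Link A d)) (a b : Link A d → Config A d G → G)
    (ha : ∀ s, Continuous (a s)) (hb : ∀ s, Continuous (b s))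
    (haC : ∀ s, DependsOn (a s) ((Cᶜ : Finset (Link A d)) : Set (Link A d)))
    (hbC : ∀ s, DependsOn (b s) ((Cᶜ : Finset (Link A d)) : Set (Link A d)))
    (g : Config A d G → ℂ) (hg : Continuous g)
    (hgC : DependsOn g ((Cᶜ : Finset (Link A d)) : Set (Link A d)))
    (hinj : Function.Injective t) (hS : ∀ j, t j ∈ C) :
    ∫ U, g U * netObs t Ω U * ∏ s ∈ C, (w (a s U * (U s)⁻¹ * b s U) : ℂ) ∂(productHaar A d G) =
      (∫ k, (w k : ℂ) ∂(haarProbability G)) ^ (C.card - Fintype.card J) * c ^ (Fintype.card J) *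
        ∫ U, g U * netObs t Ω (fun s => b s U * a s U) ∂(productHaar A d G) := by
  have hΩc := hΩ.continuous ρ hρ
  set spl := Literature.MathematicalPhysics.QuantumFieldTheory.LatticeRP.splice (G := G) C with hspl
  set F : Config A d G → ℂ := fun U => g U * netObs t Ω U *
    ∏ s ∈ C, (w (a s U * (U s)⁻¹ * b s U) : ℂ) with hF
  have hU : ∀ s, Continuous fun U : Config A d G => U s := fun s => continuous_apply s
  have hFc : Continuous F :=
    (hg.mul (continuous_netObs t hΩc)).mul (continuous_finsetProd _ fun s _ =>
      continuous_ofReal.comp (hw.comp (((ha s).mul (hU s).inv).mul (hb s))))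
  -- Fubini over the block
  have hsp : MeasurePreserving spl ((productHaar A d G).prod (productHaar A d G)) (productHaar A d G) := by
    unfold productHaar
    exact Literature.MathematicalPhysics.QuantumFieldTheory.LatticeRP.measurePreserving_splice _ C
  have h1 : ∫ U, F U ∂(productHaar A d G) =
      ∫ U, ∫ Y, F (spl (U, Y)) ∂(productHaar A d G) ∂(productHaar A d G) := by
    rw [← integral_comp_eq_of_measurePreserving hsp hFc.measurable, integral_prod]
    exact ((hFc.comp (TwistedSlab.continuous_splice C)).integrable_of_hasCompactSupport
      (HasCompactSupport.of_compactSpace _))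
  -- the integrand on the block, neighbours frozen at `U`
  have hon : ∀ U Y : Config A d G, ∀ s ∈ C, spl (U, Y) s = Y s := fun U Y s hs => by
    rw [hspl, Literature.MathematicalPhysics.QuantumFieldTheory.LatticeRP.splice_apply, if_pos hs]
  have hoff : ∀ U Y : Config A d G, ∀ s ∈ ((Cᶜ : Finset (Link A d)) : Set (Link A d)),
      spl (U, Y) s = U s := fun U Y s hs => by
    have hs' : s ∉ C := by simpa using hs
    rw [hspl, Literature.MathematicalPhysics.QuantumFieldTheory.LatticeRP.splice_apply, if_neg hs']
  have h2 : ∀ U Y : Config A d G, F (spl (U, Y)) =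
      g U * (netObs t Ω Y * ∏ s ∈ C, (w (a s U * (Y s)⁻¹ * b s U) : ℂ)) := by
    intro U Y
    rw [hF]
    simp only []
    rw [hgC (hoff U Y), mul_assoc, netObs_congr (t' := t) (U' := Y) fun j => hon U Y _ (hS j)]
    congr 2
    exact Finset.prod_congr rfl fun s hs => by rw [haC s (hoff U Y), hbC s (hoff U Y), hon U Y s hs]
  have h3 : ∀ U : Config A d G, ∫ Y, F (spl (U, Y)) ∂(productHaar A d G) =
      (∫ k, (w k : ℂ) ∂(haarProbability G)) ^ (C.card - Fintype.card J) * c ^ (Fintype.card J) *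
        (g U * netObs t Ω (fun s => b s U * a s U)) := by
    intro U
    simp_rw [h2 U]
    rw [integral_const_mul, net_slab_integral ρ hw hinv hc hρ hΩ t C (fun s => a s U)
      (fun s => b s U) hinj hS]
    ring
  rw [h1]
  simp_rw [h3]
  rw [integral_const_mul]

end Slab

end LayerNet

end Summit.QuantumFields.GaugeBoot

end
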